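import Mathlib
import Summits.CriticalPhenomena.PercolationContinuityZ3.Theorems.PercNearOneGluingNoHeavyLowerTailAntipodalStrongHarris

/-!
# Oriented, localized antipodal Hall inequality (separated type classes) via Marica–Schönheim

Helper file for crux `stmt-CriticalPhenomena-4575` (`NoHeavyLowerTail`, route `PercNearOneGluingNoHeavy`),
new-inequality factory seat `prim-ineq-gen-3` (gen 3).  Everything here is PROVED; no route definition is
touched.  Vocabulary (`Lab k`, the order `B < Cᵢ < A`, sunflower labelings) is that of
`PercNearOneGluingNoHeavyLowerTailAntipodalStrongHarris` (seat `prim-ineq-gen-1`).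

**Setting.**  `f : Finset α → Lab k` monotone (`X ⊆ Y → f X ≤ f Y`), a ground set `S`.  An *antipodal
bad set of ordered type `(i,j)`* is an `X ⊆ S` with `f X = Cᵢ`, `f (S \ X) = Cⱼ`; a *good set* is a
`U ⊆ S` with `f U = A`, `f (S \ U) = B`.  A family `D` of bad sets is *separated* if no first index of a
member equals the second index of a member (`i X ≠ j X'` for all `X, X' ∈ D`): single ordered types and
'stars' `{(i,j),(i,l)}`, `{(i,l),(j,l)}` are separated.

**Theorem (`card_le_card_goods_above`).**  For a separated family `D` of bad subsets of `S`, the good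
sets `U ⊆ S` lying above some member of `D` are at least `#D` many.  Equivalently (Hall,
`exists_injective_good_above`), the members of `D` have DISTINCT good representatives `X ⊆ φ X`.

This is the localized (every up-set), oriented (capacity one per orientation class) refinement of the
antipodal strong Harris inequality of the imported file, for separated classes.  Proof: for `X, X' ∈ D`
the set `X' ∪ (S \ X) = S \ (X \ X')` is good and contains `X'` (its label is `≥ Cᵢ(X')` and
`≥ Cⱼ(X)` with `i X' ≠ j X`, hence `A`; its complement `X \ X'` has label `≤ Cᵢ(X)` and `≤ Cⱼ(X')`
with `i X ≠ j X'`, hence `B`), and `T ↦ S \ T` is injective on subsets of `S`, so the number of such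
goods is `#(D \\ D) ≥ #D` by the Marica–Schönheim inequality (`Finset.card_le_card_diffs`).
(prim-ineq-gen-3, 2026-08-20; memo `run/shared/lean/prim/prim-ineq-gen-3/COMB.md` §3c (x)–(xi).)
-/

namespace Summit.CriticalPhenomena.PercolationContinuityZ3.Theorems

namespace OrientedAntipodalHall

open Finset AntipodalStrongHarris AntipodalStrongHarris.Lab
open scoped FinsetFamily

variable {α : Type*} [DecidableEq α] {k : ℕ}

/-- A label lying above two different petals is the top label `A`. -/
theorem eq_top_of_petal_le {i j : Fin k} (hij : i ≠ j) {c : Lab k}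
    (hi : petal i ≤ c) (hj : petal j ≤ c) : c = top := by
  rw [le_def] at hi hj
  rcases hi with h | h | h <;> rcases hj with h' | h' | h' <;> subst_vars <;> simp_all

/-- A label lying below two different petals is the bottom label `B`. -/
theorem eq_bot_of_le_petal {i j : Fin k} (hij : i ≠ j) {c : Lab k}
    (hi : c ≤ petal i) (hj : c ≤ petal j) : c = bot := by
  rw [le_def] at hi hj
  rcases hi with h | h | h <;> rcases hj with h' | h' | h' <;> subst_vars <;> simp_all

/-- **Oriented localized antipodal Hall inequality, counting form.**  Let `f` be a sunflower labeling
(monotone into `Lab k`) and `D` a *separated* family of antipodal bad subsets of `S`: every `X ∈ D`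
has `f X = C_{i X}`, `f (S \ X) = C_{j X}`, and `i X ≠ j X'` for all `X, X' ∈ D`.  Then at least `#D`
good sets `U ⊆ S` (`f U = A`, `f (S \ U) = B`) contain a member of `D`. -/
theorem card_le_card_goods_above (S : Finset α) {f : Finset α → Lab k}
    (hf : ∀ ⦃X Y : Finset α⦄, X ⊆ Y → f X ≤ f Y) (D : Finset (Finset α)) (i j : Finset α → Fin k)
    (hDS : ∀ X ∈ D, X ⊆ S) (hDi : ∀ X ∈ D, f X = petal (i X))
    (hDj : ∀ X ∈ D, f (S \ X) = petal (j X)) (hsep : ∀ X ∈ D, ∀ X' ∈ D, i X ≠ j X') :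
    #D ≤ #{U ∈ S.powerset | f U = top ∧ f (S \ U) = bot ∧ ∃ X ∈ D, X ⊆ U} := by
  -- the differences `X \ X'` of members of `D` are subsets of `S`
  have hsub : ∀ T ∈ D \\ D, T ⊆ S := by
    intro T hT
    obtain ⟨X, hX, X', -, rfl⟩ := mem_diffs.mp hT
    exact (sdiff_subset).trans (hDS X hX)
  -- complementation inside `S` is injective on subsets of `S`
  have hinj : Set.InjOn (fun T => S \ T) (D \\ D : Set (Finset α)) := by
    intro T₁ hT₁ T₂ hT₂ h
    have h₁ := Finset.sdiff_sdiff_eq_self (hsub T₁ hT₁)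
    have h₂ := Finset.sdiff_sdiff_eq_self (hsub T₂ hT₂)
    simp only at h
    rw [← h₁, ← h₂, h]
  -- every complement `S \ (X \ X') = X' ∪ (S \ X)` is a good set above `X'`
  have himg : (D \\ D).image (fun T => S \ T) ⊆
      {U ∈ S.powerset | f U = top ∧ f (S \ U) = bot ∧ ∃ X ∈ D, X ⊆ U} := by
    intro U hU
    obtain ⟨T, hT, rfl⟩ := mem_image.mp hU
    obtain ⟨X, hX, X', hX', rfl⟩ := mem_diffs.mp hT
    rw [mem_filter, mem_powerset]
    have hXS := hDS X hX
    have hX'S := hDS X' hX'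
    refine ⟨sdiff_subset, ?_, ?_, ⟨X', hX', ?_⟩⟩
    · -- label of `S \ (X \ X')` is above `C_{i X'}` and above `C_{j X}`
      refine eq_top_of_petal_le (hsep X' hX' X hX) ?_ ?_
      · rw [← hDi X' hX']
        refine hf ?_
        intro a ha
        exact mem_sdiff.mpr ⟨hX'S ha, fun h => (mem_sdiff.mp h).2 ha⟩
      · rw [← hDj X hX]
        exact hf (sdiff_subset_sdiff le_rfl sdiff_subset)
    · -- its complement `X \ X'` is below `C_{i X}` and below `C_{j X'}`
      rw [Finset.sdiff_sdiff_eq_self ((sdiff_subset).trans hXS)]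
      refine eq_bot_of_le_petal (hsep X hX X' hX') ?_ ?_
      · rw [← hDi X hX]
        exact hf sdiff_subset
      · rw [← hDj X' hX']
        exact hf (sdiff_subset_sdiff hXS le_rfl)
    · intro a ha
      exact mem_sdiff.mpr ⟨hX'S ha, fun h => (mem_sdiff.mp h).2 ha⟩
  calc #D ≤ #(D \\ D) := D.card_le_card_diffs
    _ = #((D \\ D).image fun T => S \ T) := (card_image_of_injOn hinj).symm
    _ ≤ #{U ∈ S.powerset | f U = top ∧ f (S \ U) = bot ∧ ∃ X ∈ D, X ⊆ U} := card_le_card himg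

/-- **Oriented localized antipodal Hall inequality, SDR form.**  Under the hypotheses of
`card_le_card_goods_above`, the members of the separated bad family `D` admit DISTINCT good
representatives above them: an injective `φ` on `D` with `X ⊆ φ X ⊆ S`, `f (φ X) = A`,
`f (S \ φ X) = B`. -/
theorem exists_injective_good_above (S : Finset α) {f : Finset α → Lab k}
    (hf : ∀ ⦃X Y : Finset α⦄, X ⊆ Y → f X ≤ f Y) (D : Finset (Finset α)) (i j : Finset α → Fin k)
    (hDS : ∀ X ∈ D, X ⊆ S) (hDi : ∀ X ∈ D, f X = petal (i X))
    (hDj : ∀ X ∈ D, f (S \ X) = petal (j X)) (hsep : ∀ X ∈ D, ∀ X' ∈ D, i X ≠ j X') :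
    ∃ φ : D → Finset α, Function.Injective φ ∧
      ∀ X : D, (X : Finset α) ⊆ φ X ∧ φ X ⊆ S ∧ f (φ X) = top ∧ f (S \ φ X) = bot := by
  classical
  -- Hall's marriage theorem for the relation `X ↦ good sets above X`
  let t : D → Finset (Finset α) := fun X =>
    {U ∈ S.powerset | f U = top ∧ f (S \ U) = bot ∧ (X : Finset α) ⊆ U}
  have hHall : ∀ s : Finset D, #s ≤ #(s.biUnion t) := by
    intro s
    -- the sub-family `s` (as a family of sets) is again separated
    set D' : Finset (Finset α) := s.map (Function.Embedding.subtype _) with hD'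
    have hD'sub : ∀ X ∈ D', X ∈ D := by
      intro X hX
      obtain ⟨x, -, rfl⟩ := mem_map.mp hX
      exact x.2
    have hcard : #s = #D' := (card_map _).symm
    have hle := card_le_card_goods_above S hf D' i j (fun X hX => hDS X (hD'sub X hX))
      (fun X hX => hDi X (hD'sub X hX)) (fun X hX => hDj X (hD'sub X hX))
      (fun X hX X' hX' => hsep X (hD'sub X hX) X' (hD'sub X' hX'))
    have hgoods : {U ∈ S.powerset | f U = top ∧ f (S \ U) = bot ∧ ∃ X ∈ D', X ⊆ U} ⊆
        s.biUnion t := by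
      intro U hU
      rw [mem_filter, mem_powerset] at hU
      obtain ⟨hUS, hUtop, hUbot, X, hX, hXU⟩ := hU
      obtain ⟨x, hx, rfl⟩ := mem_map.mp hX
      rw [mem_biUnion]
      refine ⟨x, hx, ?_⟩
      simp only [t, mem_filter, mem_powerset]
      exact ⟨hUS, hUtop, hUbot, hXU⟩
    calc #s = #D' := hcard
      _ ≤ #{U ∈ S.powerset | f U = top ∧ f (S \ U) = bot ∧ ∃ X ∈ D', X ⊆ U} := hle
      _ ≤ #(s.biUnion t) := card_le_card hgoods
  obtain ⟨φ, hφinj, hφ⟩ := (all_card_le_biUnion_card_iff_exists_injective t).mp hHall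
  refine ⟨φ, hφinj, fun X => ?_⟩
  have hX := hφ X
  simp only [t, mem_filter, mem_powerset] at hX
  exact ⟨hX.2.2.2, hX.1, hX.2.1, hX.2.2.1⟩

end OrientedAntipodalHall

end Summit.CriticalPhenomena.PercolationContinuityZ3.Theorems
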